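import Summits.NavierStokesRegularity.NavierStokesRegularity.Theorems.PerpetualPumpAveragedTypeIBlowupPulseBootFront
import Summits.NavierStokesRegularity.NavierStokesRegularity.Theorems.PerpetualPumpAveragedTypeIBlowupPulseBootLevel
import Summits.NavierStokesRegularity.NavierStokesRegularity.Theorems.PerpetualPumpAveragedTypeIBlowupPulseBootLadder
import Summits.NavierStokesRegularity.NavierStokesRegularity.Theorems.PerpetualPumpAveragedTypeIBlowupPulseBootPrev
import Summits.NavierStokesRegularity.NavierStokesRegularity.Theorems.PerpetualPumpAveragedTypeIBlowupPreBootTrail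
import Mathlib.Order.Filter.Finite

/-!
# Crux `PerpetualPump.AveragedTypeIBlowup` (stmt-NavierStokesRegularity-1835), line `Sketch`:
# stub `pulseBoot` — one step of the joint continuous induction

Sixth file of the proof of the registered stub `stub_pulseBoot`. On a truncated pulse horizon
`[tι, S]`, the 2× LOOSER bounds on every mode imply the TIGHT box `Pul` on `[tι, S]`
(`pulseBoot_step`): the trail (`preBoot_trail`), the front (`pulseBoot_front`), the previous pair
(`pulseBoot_prevPair`, fed by the tight trail bond and the tight front carrier), the level-1 pair
(`pulseBoot_levelOne`) and the ladder (`pulseBoot_ladder`, fed by `2Y₁`). Also the two topological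
halves of the continuous induction (`pulseBoot_closed_le` = registered tools sub-goal
`stub_pulseBootStep`, `pulseBoot_open`).

## References

T. Tao, *Finite time blowup for an averaged three-dimensional Navier–Stokes equation*, J. Amer.
Math. Soc. 29 (2016), 601–674, §5–6 (the cascade / transfer-pulse heuristics); the content here is
folklore ODE calculus (comparison, Duhamel bounds, continuous induction).
-/

noncomputable section

-- the summit namespace `…NavierStokesRegularity.NavierStokesRegularity…` is the tree convention
set_option linter.dupNamespace false

open Set MeasureTheory Filter Topology

namespace Summit.NavierStokesRegularity.NavierStokesRegularity.Theorems.PerpetualPumpAveragedTypeIBlowup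

/-- **A non-strict inequality between functions continuous on `[0, T]` passes to the right end
of `[a, t) ⊆ [0, T]`** (`[a, t]` is the closure of `[a, t)`). [folklore] -/
theorem pulseBoot_closed_le {f g : ℝ → ℝ} {a t T : ℝ} (hf : ContinuousOn f (Icc 0 T))
    (hg : ContinuousOn g (Icc 0 T)) (ha : 0 ≤ a) (hat : a < t) (htT : t ≤ T)
    (h : ∀ u ∈ Ico a t, f u ≤ g u) : f t ≤ g t := by
  have hsub : Ico a t ⊆ Icc 0 T := fun u hu => ⟨ha.trans hu.1, hu.2.le.trans htT⟩
  have ht : t ∈ Icc 0 T := ⟨by linarith, htT⟩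
  have hcl : t ∈ closure (Ico a t) := by
    rw [closure_Ico hat.ne]
    exact ⟨hat.le, le_rfl⟩
  exact ContinuousWithinAt.closure_le hcl ((hf t ht).mono hsub) ((hg t ht).mono hsub) h

/-- **Strict inequalities of functions continuous on `[0, T]` persist near a point of
`[a, b] ⊆ [0, T]`** (as non-strict ones, eventually in `𝓝[[a, b]] t`). [folklore] -/
theorem pulseBoot_open {f : ℝ → ℝ} {a b t T C : ℝ} (hf : ContinuousOn f (Icc 0 T))
    (hsub : Icc a b ⊆ Icc 0 T) (ht : t ∈ Icc a b) :
    (f t < C → ∀ᶠ u in 𝓝[Icc a b] t, f u ≤ C) ∧ (C < f t → ∀ᶠ u in 𝓝[Icc a b] t, C ≤ f u) := by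
  have hft : ContinuousWithinAt f (Icc a b) t := (hf.mono hsub) t ht
  have hc : ContinuousWithinAt (fun _ : ℝ => C) (Icc a b) t := continuousWithinAt_const
  exact ⟨fun h => (preBoot_eventually_lt hft hc h).mono fun u hu => hu.le,
    fun h => (preBoot_eventually_lt hc hft h).mono fun u hu => hu.le⟩

set_option maxHeartbeats 1600000 in
/-- **The tight boxes from the loose ones during the pulse (one step of the joint continuous
induction).** In the context of the window one-step theorem after the first ignition at `tι`
(pre-ignition box `Pre` on `[t₀, tι]`, ignition data at `tι`), on a truncated pulse horizon
`[tι, S]` (`R_n(S − tι) ≤ σ_P`): if every mode satisfies the 2× LOOSER bounds on `[tι, S]`, then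
every mode satisfies its TIGHT box `Pul` on `[tι, S]` (and the next bond is even `≤ Y₁`): the
trail (`preBoot_trail` on `[t₀, S]`), the front (`pulseBoot_front`), the previous pair
(`pulseBoot_prevPair` on `[t₀, S]`, fed by the tight trail bond and the tight front carrier),
the level-1 pair (`pulseBoot_levelOne`, fed by the tight front) and the ladder
(`pulseBoot_ladder` on `[t₀, S]`, fed by the loose next bond `2Y₁`). [folklore] -/
theorem pulseBoot_step :
    ∀ (ε₀ D εb θ η F blo bhi : ℝ) (n₀ : ℤ) (bv wv M0 M1 db dw : ℤ → ℝ → ℝ) (q : ℝ) (R : ℤ → ℝ) (lad : ℕ → ℝ)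
      (G0 G1 : ℤ → ℝ → ℝ) (Inv : ℤ → ℝ → ℝ → Prop) (Tube : ℤ → ℝ → Prop) (n : ℤ) (B t₀ T : ℝ),
      q = Real.sqrt (1 + ε₀) → (∀ k : ℤ, R k = D * (1 + ε₀) ^ (2 * k)) →
      (∀ j : ℕ, lad j = εb * ((1 + ε₀) ^ (19 * (j - 2)))⁻¹) →
      (∀ (k : ℤ) (t : ℝ), G0 k t = (wv (k - 1) t) ^ 2 / q ^ 3 - (wv k t) ^ 2 - εb * bv k t * wv k t) →
      (∀ (k : ℤ) (t : ℝ), G1 k t = wv k t * (bv k t - bv (k + 1) t / q) + εb * (bv k t) ^ 2) →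
      (∀ (m : ℤ) (Bm t : ℝ), Inv m Bm t ↔
        (bv m t = Bm ∧ (∀ s ∈ Icc 0 t, bv m s ≤ Bm) ∧
        (0 ≤ wv m t ∧ wv m t ≤ F * εb * Bm ∧ M1 m t ≤ F * εb * Bm ∧ M0 m t ≤ 2 * Bm) ∧
        (n₀ ≤ m - 1 → 0 ≤ wv (m - 1) t ∧ q ^ 3 * Bm - 1 ≤ (wv (m - 1) t) ^ 2 ∧
          (wv (m - 1) t) ^ 2 ≤ q ^ 3 * Bm + 1 ∧ 9 / 20 ≤ bv (m - 1) t ∧ bv (m - 1) t ≤ 11 / 20 ∧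
          M0 (m - 1) t ≤ 5 * (bhi + 4) ^ 2 ∧ M1 (m - 1) t ≤ 5 * (bhi + 4) ^ 2) ∧
        (|bv (m + 1) t| ≤ εb ∧ |wv (m + 1) t| ≤ εb ∧ M0 (m + 1) t ≤ εb ∧ M1 (m + 1) t ≤ εb) ∧
        (∀ j : ℕ, 2 ≤ j → |bv (m + j) t| ≤ lad j ∧ |wv (m + j) t| ≤ lad j / 5 ∧
          M0 (m + j) t ≤ lad j ∧ M1 (m + j) t ≤ lad j) ∧
        (∀ j : ℕ, 1 ≤ j → ∀ s ∈ Icc 0 t, bv (m + j) s ≤ 1 / 2) ∧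
        (∀ k : ℤ, n₀ ≤ k → k ≤ m - 2 → ∃ te ∈ Icc 0 t,
          (-(2 / 5) ≤ bv k te ∧ bv k te ≤ 3 / 10 ∧ |wv k te| ≤ 1 / 200 ∧
            M0 k te ≤ 10 * (bhi + 4) ^ 2 ∧ M1 k te ≤ 10 * (bhi + 4) ^ 2) ∧
          ∀ s ∈ Icc te t, -(9 / 20) ≤ bv k s ∧ bv k s ≤ 7 / 20 ∧ |wv k s| ≤ 1 / 100 ∧
            M0 k s ≤ 10 * (bhi + 4) ^ 2 + 1 ∧ M1 k s ≤ 10 * (bhi + 4) ^ 2 + 1 ∧ |wv (k - 1) s| ≤ 1 / 100 ∧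
            -(1 / 2) ≤ bv (k + 1) s ∧ bv (k + 1) s ≤ 9 / 10))) →
      (∀ (m : ℤ) (t : ℝ), Tube m t ↔
        ((∀ k : ℤ, k ≤ m + 1 → |bv k t| ≤ 2 * (bhi + 3) ∧ |wv k t| ≤ 2 * (bhi + 3) ∧
          M0 k t ≤ 20 * (bhi + 4) ^ 2 ∧ M1 k t ≤ 20 * (bhi + 4) ^ 2) ∧
        (∀ j : ℕ, 2 ≤ j → |bv (m + j) t| ≤ lad j ∧ |wv (m + j) t| ≤ lad j ∧
          M0 (m + j) t ≤ lad j ∧ M1 (m + j) t ≤ lad j))) →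
      -- regime
      0 < ε₀ → ε₀ ≤ 1 / 20 → 0 < D → 1 / 2 ≤ θ → θ ≤ 1 → 0 ≤ η → 0 < εb → εb ≤ 1 / 10 ^ 6 →
      10 ^ 4 + 40 - 5 * Real.log εb ≤ blo → 10 ^ 9 * (bhi + 4) ^ 4 ≤ F →
      η * (10 ^ 9 * (bhi + 4) ^ 4 * (F + 1)) ≤ 1 → εb * (10 ^ 9 * (F + 1) ^ 2 * (bhi + 4) ^ 3) ≤ 1 →
      10 ^ 3 + 20 * Real.log (bhi + 5) + Real.log (F + 2) ≤ -Real.log εb →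
      -- the critical system with memory errors on [0, T]
      n₀ ≤ n → 0 ≤ t₀ → t₀ < T → blo ≤ B → B ≤ bhi →
      (∀ k : ℤ, k < n₀ → ∀ t ∈ Icc 0 T, bv k t = 0 ∧ wv k t = 0 ∧ M0 k t = 0 ∧ M1 k t = 0) →
      (∀ k : ℤ, ContinuousOn (bv k) (Icc 0 T) ∧ ContinuousOn (wv k) (Icc 0 T) ∧
        ContinuousOn (M0 k) (Icc 0 T) ∧ ContinuousOn (M1 k) (Icc 0 T)) →
      (∀ k : ℤ, ContinuousOn (db k) (Icc 0 T) ∧ ContinuousOn (dw k) (Icc 0 T) ∧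
        ∀ t ∈ Ioo 0 T, HasDerivAt (bv k) (db k t) t ∧
          |db k t - R k * (-(bv k t) + G0 k t)| ≤ η * R k * M0 k t ∧
          HasDerivAt (wv k) (dw k t) t ∧ |dw k t - R k * (-(wv k t) + G1 k t)| ≤ η * R k * M1 k t) →
      (∀ k : ℤ, ∀ t ∈ Icc 0 T, |bv k t| ≤ M0 k t ∧ |wv k t| ≤ M1 k t ∧ 0 ≤ M0 k t ∧ 0 ≤ M1 k t) →
      (∀ k : ℤ, ∀ t₁ ∈ Icc 0 T, ∀ t₂ ∈ Icc t₁ T,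
        M0 k t₂ ≤ M0 k t₁ * Real.exp (-(θ * R k * (t₂ - t₁))) +
          R k * ∫ u in t₁..t₂, Real.exp (-(θ * R k * (t₂ - u))) * |G0 k u| ∧
        M1 k t₂ ≤ M1 k t₁ * Real.exp (-(θ * R k * (t₂ - t₁))) +
          R k * ∫ u in t₁..t₂, Real.exp (-(θ * R k * (t₂ - u))) * |G1 k u|) →
      -- the a-priori far tail above the front, and the hand-off invariant at t₀
      (∃ J : ℕ, ∀ j : ℕ, J ≤ j → ∀ t ∈ Icc 0 T,
        |bv (n + j) t| ≤ lad j ∧ |wv (n + j) t| ≤ lad j / 5 ∧ M0 (n + j) t ≤ lad j ∧ M1 (n + j) t ≤ lad j) →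
      Inv n B t₀ →
      ∀ (Pre Pul : ℝ → Prop) (tι S : ℝ),
      (∀ s : ℝ, Pre s ↔
        ((B * Real.exp (-(R n * (s - t₀))) - 3 / 2 ≤ bv n s ∧ bv n s ≤ B * Real.exp (-(R n * (s - t₀))) + 5 / 2 ∧
          0 ≤ wv n s ∧ M0 n s ≤ 6 * (B + 3) ∧
          M1 n s ≤ F * εb * B + 2 * wv n s + 2 * εb * (B + 3) ^ 2 * (R n * (s - t₀))) ∧
        (n₀ ≤ n - 1 → -(1 / 100) ≤ wv (n - 1) s ∧ (wv (n - 1) s) ^ 2 ≤ q ^ 3 * B + 2 ∧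
          -(2 / 5) ≤ bv (n - 1) s ∧ bv (n - 1) s ≤ 17 / 20 ∧
          (t₀ + 2 * (100 + 4 * Real.log (bhi + 5)) / (B * R n) ≤ s → |wv (n - 1) s| ≤ 1 / 200 ∧ bv (n - 1) s ≤ 3 / 10) ∧
          M0 (n - 1) s ≤ 6 * (bhi + 4) ^ 2 ∧ M1 (n - 1) s ≤ 6 * (bhi + 4) ^ 2 ∧
          (1 + ε₀) ^ (-(2 : ℤ)) * R n * ∫ u in t₀..s, (wv (n - 1) u) ^ 2 ≤ 9 / 10) ∧
        (|bv (n + 1) s| ≤ εb + q / 100 + 1 / 10 ^ 3 ∧ |wv (n + 1) s| ≤ 11 / 10 * εb ∧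
          M0 (n + 1) s ≤ εb + (B + 3) / 40 ∧ M1 (n + 1) s ≤ 4 * εb) ∧
        (∀ j : ℕ, 2 ≤ j → |bv (n + j) s| ≤ lad j ∧ |wv (n + j) s| ≤ lad j / 5 ∧
          M0 (n + j) s ≤ lad j ∧ M1 (n + j) s ≤ lad j) ∧
        (∀ k : ℤ, n₀ ≤ k → k ≤ n - 2 → -(9 / 20) ≤ bv k s ∧ bv k s ≤ 7 / 20 ∧ |wv k s| ≤ 1 / 100 ∧
          M0 k s ≤ 10 * (bhi + 4) ^ 2 + 1 ∧ M1 k s ≤ 10 * (bhi + 4) ^ 2 + 1))) →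
      (∀ s : ℝ, Pul s ↔
        ((-(1 / 2) ≤ bv n s ∧ bv n s ≤ bv n tι + 1 / 100 ∧ |wv n s| ≤ bv n tι + 1 / 100 ∧
          -(q / 50) ≤ bv (n + 1) s ∧ bv (n + 1) s ≤ q * (bv n tι + 1 / 100) ∧
          M0 n s ≤ 3 * (bhi + 4) ^ 2 ∧ M1 n s ≤ 5 * (bhi + 4) ^ 2 ∧ M0 (n + 1) s ≤ 3 / 2 * B ∧
          |wv (n + 1) s| ≤ 1 / 10 ^ 3 ∧ M1 (n + 1) s ≤ 1) ∧
        (n₀ ≤ n - 1 → |wv (n - 1) s| ≤ 1 / 200 ∧ -(2 / 5) ≤ bv (n - 1) s ∧ bv (n - 1) s ≤ 3 / 10 ∧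
          M0 (n - 1) s ≤ 6 * (bhi + 4) ^ 2 ∧ M1 (n - 1) s ≤ 6 * (bhi + 4) ^ 2 ∧
          (1 + ε₀) ^ (-(2 : ℤ)) * R n * ∫ u in t₀..s, (wv (n - 1) u) ^ 2 ≤ 9 / 10) ∧
        (∀ j : ℕ, 2 ≤ j → |bv (n + j) s| ≤ lad j ∧ |wv (n + j) s| ≤ lad j / 5 ∧
          M0 (n + j) s ≤ lad j ∧ M1 (n + j) s ≤ lad j) ∧
        (∀ k : ℤ, n₀ ≤ k → k ≤ n - 2 → -(9 / 20) ≤ bv k s ∧ bv k s ≤ 7 / 20 ∧ |wv k s| ≤ 1 / 100 ∧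
          M0 k s ≤ 10 * (bhi + 4) ^ 2 + 1 ∧ M1 k s ≤ 10 * (bhi + 4) ^ 2 + 1))) →
      t₀ < tι → tι ≤ t₀ + 3 / R n → t₀ + 2 * (100 + 4 * Real.log (bhi + 5)) / (B * R n) ≤ tι → 10 ^ 4 ≤ bv n tι →
      (∀ s ∈ Icc t₀ tι, Pre s) → (∀ s ∈ Ioc t₀ tι, 0 < wv n s) → (R n * ∫ u in t₀..tι, (wv n u) ^ 2 ≤ 1 / 100) →
      (∀ s ∈ Icc t₀ tι, (wv n s) ^ 2 ≤ bv n s / 100) → (wv n tι) ^ 2 = bv n tι / 100 →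
      bv n tι ≤ B + Real.log (10 * (F + 2) * εb * B) + 6 * (R n * (tι - t₀) + 1) →
      B * (1 - Real.exp (-(R n * (tι - t₀)))) ≤
        max 0 (Real.log (6 / 10 * Real.sqrt (B + 4) / (εb * B))) + 6 * (R n * (tι - t₀) + 1) + 2 →
      tι ≤ S → S ≤ T → S ≤ tι + (5 * Real.log (bv n tι) + 20) / bv n tι / R n →
      (∀ u ∈ Icc tι S,
        (|wv (n - 1) u| ≤ 1 / 100 ∧ -(1 / 2) ≤ bv (n - 1) u ∧ bv (n - 1) u ≤ 9 / 10) ∧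
        (|bv n u| ≤ 2 * (bhi + 4) ∧ |wv n u| ≤ 2 * (bhi + 4) ∧ M0 n u ≤ 6 * (bhi + 4) ^ 2 ∧
          M1 n u ≤ 10 * (bhi + 4) ^ 2) ∧
        (|bv (n + 1) u| ≤ 3 * (bhi + 4) ∧ |wv (n + 1) u| ≤ 2 * (Real.exp 25 * εb * (bhi + 4) ^ 8) ∧
          M0 (n + 1) u ≤ 3 * B) ∧ |bv (n + 2) u| ≤ 1 / 2 ∧
        (∀ k : ℤ, n₀ ≤ k → k ≤ n - 2 → |wv k u| ≤ 1 / 50 ∧ -(1 / 2) ≤ bv k u ∧ bv k u ≤ 9 / 10)) →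
      ∀ u ∈ Icc tι S, Pul u ∧ |wv (n + 1) u| ≤ Real.exp 25 * εb * (bhi + 4) ^ 8 := by
  intro ε₀ D εb θ η F blo bhi n₀ bv wv M0 M1 db dw q R lad G0 G1 Inv Tube n B t₀ T hq hR hlad hG0 hG1
    hInv _ hε₀ hε₀' hD hθ hθ1 hη hεb hεb6 hblo hF hηreg hεbreg hseed hn₀ ht₀ _ hBlo hBhi hzero hcont
    hC1 hmaj hrest hTail hInvt Pre Pul tι S hPre hPul htι htι3 hσI hB' hPreι hpos _ _ hig _ _
    hS hST hSP hL
  obtain ⟨hεb1, hB4, hB1, hF0, hFεB, -, hq1, hq21⟩ :=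
    oneStepCore_regime hε₀ hε₀' hεb hεb6 hblo hF hεbreg hBlo hBhi hq
  have hbhi : 1 ≤ bhi + 4 := by linarith
  obtain ⟨hRpos, -, -, -, -, -, -, -, -, hq0, -⟩ := preBoot_rates hε₀ hε₀' hD hR hq n
  have hRn := hRpos n
  obtain ⟨hY0, hY2, hY3, hY20, hYε, -⟩ := pulseBoot_Y hεb hF0 hbhi hseed
  set Y₁ := Real.exp 25 * εb * (bhi + 4) ^ 8 with hY₁
  have hT : 0 < T := by linarith
  have ht₀S : t₀ ≤ S := by linarith
  -- the hand-off invariant and the pre-ignition box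
  obtain ⟨-, -, -, hP, -, hLad, -, hTr⟩ := (hInv n B t₀).1 hInvt
  have hPre' : ∀ s ∈ Icc t₀ tι, _ := fun s hs => (hPre s).1 (hPreι s hs)
  obtain ⟨⟨-, f2ι, -, f4ι, f5ι⟩, -, ⟨l1ι, l2ι, l3ι, l4ι⟩, -, -⟩ := hPre' tι ⟨htι.le, le_rfl⟩
  obtain ⟨hclock3, -, -, -, -⟩ := oneStepCore_clock (t₀ := t₀) hRn
  have hσι3 : R n * (tι - t₀) ≤ 3 := hclock3 tι htι3
  have hB'B : bv n tι ≤ B + 5 / 2 := by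
    have := oneStepCore_mul_exp_neg_le (by linarith : 0 ≤ B)
      (mul_nonneg hRn.le (by linarith : 0 ≤ tι - t₀))
    linarith
  -- the front lower envelope before ignition is far above `−1/2`
  have hlow : ∀ u ∈ Icc t₀ tι, -(1 / 2) ≤ bv n u ∧ bv n u ≤ B + 3 := by
    intro u hu
    obtain ⟨⟨f1, f2, -⟩, -⟩ := hPre' u hu
    have hσ0 : 0 ≤ R n * (u - t₀) := mul_nonneg hRn.le (by linarith [hu.1])
    have hσ3 : R n * (u - t₀) ≤ 3 := by nlinarith [hu.2]
    have he : Real.exp (-3) ≤ Real.exp (-(R n * (u - t₀))) := Real.exp_le_exp.2 (by linarith)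
    have he3 : 1 / 21 ≤ Real.exp (-3) := by
      rw [Real.exp_neg, div_le_iff₀ (by norm_num : (0:ℝ) < 21), inv_mul_eq_div, le_div_iff₀ (Real.exp_pos 3)]
      linarith [preBoot_exp_three]
    have h1 : B * (1 / 21) ≤ B * Real.exp (-(R n * (u - t₀))) :=
      mul_le_mul_of_nonneg_left (he3.trans he) (by linarith)
    have h2 := oneStepCore_mul_exp_neg_le (by linarith : 0 ≤ B) hσ0
    exact ⟨by linarith, by linarith⟩
  -- 1. the trail on `[t₀, S]`
  have htr := preBoot_trail ε₀ D εb θ η F bhi q T t₀ S n₀ n bv wv M0 M1 db dw G0 G1 R hq hR hG0 hG1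
    hε₀ hε₀' hD hθ hθ1 hη hεb hεb6 hF0 hbhi hηreg hzero hcont hC1 hmaj hrest hT ht₀S hST hTr
    (fun u hu k hk1 hk2 => by
      rcases le_total u tι with h | h
      · obtain ⟨-, -, -, -, tr⟩ := hPre' u ⟨hu.1, h⟩
        obtain ⟨a1, a2, a3, -⟩ := tr k hk1 hk2
        exact ⟨a3.trans (by norm_num), by linarith, by linarith⟩
      · exact (hL u ⟨h, hu.2⟩).2.2.2.2 k hk1 hk2)
    (fun hn1 u hu => by
      rcases le_total u tι with h | h
      · obtain ⟨-, pp, -⟩ := hPre' u ⟨hu.1, h⟩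
        obtain ⟨-, -, a3, a4, -⟩ := pp hn1
        exact ⟨by linarith, by linarith⟩
      · obtain ⟨⟨-, a2, a3⟩, -⟩ := hL u ⟨h, hu.2⟩
        exact ⟨a2, a3⟩)
  -- 2. the front on `[tι, S]`
  have hM1ι : M1 n tι ≤ F * εb * B + 2 * wv n tι + 2 * εb * (B + 3) ^ 2 * 3 := by
    have : 2 * εb * (B + 3) ^ 2 * (R n * (tι - t₀)) ≤ 2 * εb * (B + 3) ^ 2 * 3 :=
      mul_le_mul_of_nonneg_left hσι3 (by positivity)
    linarith
  have hfr := pulseBoot_front (Y₁ := Y₁) hq hR hG0 hG1 hε₀ hε₀' hD hθ hη hεb hεb6 hblo hF hηreg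
    hεbreg hBlo hBhi hcont hC1 hmaj hrest hT ht₀ htι hS hST hSP hB' hB'B (hpos tι ⟨htι, le_rfl⟩)
    hig l1ι f4ι hM1ι hY2
    (fun u hu => by
      obtain ⟨⟨a1, -, -⟩, ⟨b1, b2, b3, b4⟩, ⟨c1, c2, c3⟩, -, -⟩ := hL u hu
      exact ⟨a1, b1, b2, b3, b4, c1, c2, c3⟩)
  -- 3. the previous pair on `[t₀, S]`
  have hS10 : R n * (S - t₀) ≤ 10 := by
    obtain ⟨-, -, -, hσP⟩ := pulseBoot_sigmaP hB'
    have h1 : R n * (S - tι) ≤ (5 * Real.log (bv n tι) + 20) / bv n tι := by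
      have h2 : S - tι ≤ (5 * Real.log (bv n tι) + 20) / bv n tι / R n := by linarith
      calc R n * (S - tι) ≤ R n * ((5 * Real.log (bv n tι) + 20) / bv n tι / R n) :=
            mul_le_mul_of_nonneg_left h2 hRn.le
        _ = _ := mul_div_cancel₀ _ hRn.ne'
    have e : R n * (S - t₀) = R n * (S - tι) + R n * (tι - t₀) := by ring
    linarith
  have hpp : n₀ ≤ n - 1 → ∀ u ∈ Icc t₀ S, _ := fun hn1 =>
    pulseBoot_prevPair ε₀ D εb θ η F blo bhi q T t₀ S B n₀ n bv wv M0 M1 db dw G0 G1 R hq hR hG0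
      hG1 hε₀ hε₀' hD hθ hθ1 hη hεb hεb6 hblo hF hηreg hεbreg hseed hBlo hBhi hzero hcont hC1 hmaj
      hrest hT ht₀ (by linarith) hST hS10 hn1 (hP hn1)
      (fun hn2 u hu => (htr (n - 2) hn2 le_rfl u hu).2.2.1)
      (fun u hu => by
        rcases le_total u tι with h | h
        · exact hlow u ⟨hu.1, h⟩
        · obtain ⟨a1, a2, -⟩ := hfr u ⟨h, hu.2⟩
          exact ⟨a1, by linarith⟩)
      (fun u hu huI => by
        obtain ⟨⟨f1, -⟩, -⟩ := hPre' u ⟨hu.1, huI.trans hσI⟩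
        linarith)
  -- 4. the level-1 pair on `[tι, S]`
  have hl1 := pulseBoot_levelOne hq hR hG0 hG1 hε₀ hε₀' hD hθ hθ1 hη hεb hεb6 hblo hF hηreg hεbreg
    hseed hBlo hBhi hcont hC1 hmaj hrest hT ht₀ htι hS hST hSP hB' hB'B l2ι l4ι l3ι
    (fun u hu => by
      obtain ⟨-, -, -, a4, a5, -, -, a8⟩ := hfr u hu
      exact ⟨a4, a5, a8⟩)
    (fun u hu => by
      obtain ⟨-, -, ⟨c1, c2, -⟩, d, -⟩ := hL u hu
      exact ⟨d, c2.trans hY2, c1⟩)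
  -- 5. the ladder on `[t₀, S]`, fed by `|w_{n+1}| ≤ 2Y₁`
  have hld := pulseBoot_ladder (Yl := 2 * Y₁) hq hR hlad hG0 hG1 hε₀ hε₀' hD hθ hθ1 hη hεb hεb6 hF0
    hbhi hηreg hcont hC1 hmaj hrest hT ht₀ ht₀S hST hTail hLad (by positivity)
    (by nlinarith)
    (fun u hu => by
      rcases le_total u tι with h | h
      · obtain ⟨-, -, ⟨-, l2, -⟩, -⟩ := hPre' u ⟨hu.1, h⟩
        linarith
      · exact (hL u ⟨h, hu.2⟩).2.2.1.2.1)
  -- the tight box `Pul`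
  intro u hu
  have hut : u ∈ Icc t₀ S := ⟨by linarith [hu.1], hu.2⟩
  obtain ⟨a1, a2, a3, a4, a5, a6, a7, -⟩ := hfr u hu
  obtain ⟨b1, b2, b3⟩ := hl1 u hu
  refine ⟨(hPul u).2 ⟨⟨a1, a2, a3, a4, a5, a6, a7, b3, b1.trans hY3, b2⟩, fun hn1 => ?_,
    fun j hj => hld j hj u hut, fun k hk1 hk2 => htr k hk1 hk2 u hut⟩, b1⟩
  obtain ⟨-, -, p3, -, p5, p6, p7, p8⟩ := hpp hn1 u hut
  obtain ⟨q1, q2⟩ := p5 (hσI.trans hu.1)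
  exact ⟨q1, p3, q2, p6, p7, p8⟩

/-- **Registered tools sub-goal `stub_pulseBootStep`** of the stub `pulseBoot` (line `Sketch`, crux
stmt-NavierStokesRegularity-1835): a non-strict inequality between functions continuous on
`[0, T]` passes to the right end of `[a, t) ⊆ [0, T]` (`pulseBoot_closed_le`, the closedness half
of the continuous induction). [folklore] -/
theorem stub_pulseBootStep :
    ∀ (f g : ℝ → ℝ) (a t T : ℝ), ContinuousOn f (Icc 0 T) → ContinuousOn g (Icc 0 T) →
      0 ≤ a → a < t → t ≤ T → (∀ u ∈ Ico a t, f u ≤ g u) → f t ≤ g t :=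
  fun _ _ _ _ _ hf hg ha hat htT h => pulseBoot_closed_le hf hg ha hat htT h

end Summit.NavierStokesRegularity.NavierStokesRegularity.Theorems.PerpetualPumpAveragedTypeIBlowup

end
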